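import Summits.AtomisticToContinuum.Crystallization.Theorems.ThreeConeCertificateSlackRigidityPricedFloorsGlobalize1

/-!
# Globalisation of exact local layerings, II: the first shell of an admissible layered set

Helper file 2 for the stub `stub_globalize` of the line `priced-floors-palm-exactification`
(crux `ThreeConeCertificate.SlackRigidity`, item 11960).  In the integer codes of file I:
`layeredSet A a s z = A '' stdL a s z`; the nonzero points of the standard admissible layered set
`stdL a s z` (with `z 0 = 0`) of norm `≤ 28/25` are exactly the twelve points of the shell pattern
`shellSet a (s 0) (z 1) (−s (−1)) (z (−1))` (six in-plane neighbours at distance `a`, three points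
of the layer above over holes of type `s 0`, three of the layer below over holes of type
`−s (−1)`); uniform discreteness (`> 9/10`) and the second-shell bound (`≤ 9/5`).  All `[folklore]`.
-/

noncomputable section

open Set
open Literature.MathematicalPhysics.StatisticalMechanics
open Summit.AtomisticToContinuum.Crystallization.Theorems.SlackRigidityPricedFloors

namespace Summit.AtomisticToContinuum.Crystallization.Theorems.SlackRigidityPricedFloorsGlobalize

variable {a : ℝ}

/-! ## More code facts -/

/-- `lat (0, 0) = 0`. [folklore] -/
@[simp] theorem lat_zero' (a : ℝ) : lat a (0, 0) = 0 := lat_zero a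

/-- The rotated neighbour of a hexagon code is an adjacent hexagon code. [folklore] -/
theorem rot_mem_hexCodes {c : ℤ × ℤ} (hc : c ∈ hexCodes) :
    rot c ∈ hexCodes ∧ c - rot c ∈ hexCodes ∧ rot c - c ∈ hexCodes := by
  revert c hc; decide

/-- The five other vertices of the hexagon through `c` differ from `c`. [folklore] -/
theorem rot_ne {c : ℤ × ℤ} (hc : c ∈ hexCodes) :
    rot c ≠ c ∧ -rot c ≠ c ∧ rot c - c ≠ c ∧ c - rot c ≠ c ∧ -c ≠ c := by
  revert c hc; decide

/-- Sum of a hexagon code and a different hexagon code is short (`Q ≤ 27`). [folklore] -/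
theorem Qf_hex_add_hex {c c' : ℤ × ℤ} (hc : c ∈ hexCodes) (hc' : c' ∈ hexCodes) (hne : c' ≠ c) :
    Qf (c + c') ≤ 27 := by
  have key : ∀ c ∈ hexCodes, ∀ c' ∈ hexCodes, c' ≠ c → Qf (c + c') ≤ 27 := by decide
  exact key c hc c' hc' hne

/-- Sum of a hexagon code and a hole code is short (`Q ≤ 21`). [folklore] -/
theorem Qf_hex_add_up {σ : ℤ} (hσ : σ = 1 ∨ σ = -1) {c c' : ℤ × ℤ} (hc : c ∈ hexCodes)
    (hc' : c' ∈ upCodes σ) : Qf (c + c') ≤ 21 := by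
  have key : ∀ σ ∈ signs, ∀ c ∈ hexCodes, ∀ c' ∈ upCodes σ, Qf (c + c') ≤ 21 := by decide
  exact key σ (mem_signs.2 hσ) c hc c' hc'

/-- `Q ≥ 0`. [folklore] -/
theorem Qf_nonneg (c : ℤ × ℤ) : 0 ≤ Qf c := by
  unfold Qf; nlinarith [sq_nonneg (2 * c.1 + c.2), sq_nonneg c.2]

/-- The unit solutions of the triangular form. [folklore] -/
theorem hexCodes_of_form_eq_one {i j : ℤ} (h : i ^ 2 + i * j + j ^ 2 = 1) :
    ((3 * i, 3 * j) : ℤ × ℤ) ∈ hexCodes := by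
  have hj : j ^ 2 ≤ 1 := by nlinarith [sq_nonneg (2 * i + j)]
  have hi : i ^ 2 ≤ 1 := by nlinarith [sq_nonneg (2 * j + i)]
  have hi1 : -1 ≤ i := by nlinarith
  have hi2 : i ≤ 1 := by nlinarith
  have hj1 : -1 ≤ j := by nlinarith
  have hj2 : j ≤ 1 := by nlinarith
  interval_cases i <;> interval_cases j <;> simp_all <;> decide

/-- The solutions of the shifted triangular form (holes of type `σ` nearest to a site).
[folklore] -/
theorem upCodes_of_form_eq_zero {σ : ℤ} (hσ : σ = 1 ∨ σ = -1) {i j : ℤ}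
    (h : i ^ 2 + i * j + j ^ 2 + σ * (i + j) = 0) :
    ((3 * i + σ, 3 * j + σ) : ℤ × ℤ) ∈ upCodes σ := by
  rcases hσ with rfl | rfl
  · have hj : 3 * j ^ 2 + 2 * j ≤ 1 := by nlinarith [sq_nonneg (2 * i + j + 1)]
    have hi : 3 * i ^ 2 + 2 * i ≤ 1 := by nlinarith [sq_nonneg (2 * j + i + 1)]
    have hi1 : -1 ≤ i := by nlinarith
    have hi2 : i ≤ 0 := by nlinarith
    have hj1 : -1 ≤ j := by nlinarith
    have hj2 : j ≤ 0 := by nlinarith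
    interval_cases i <;> interval_cases j <;> simp_all <;> decide
  · have hj : 3 * j ^ 2 - 2 * j ≤ 1 := by nlinarith [sq_nonneg (2 * i + j - 1)]
    have hi : 3 * i ^ 2 - 2 * i ≤ 1 := by nlinarith [sq_nonneg (2 * j + i - 1)]
    have hi1 : 0 ≤ i := by nlinarith
    have hi2 : i ≤ 1 := by nlinarith
    have hj1 : 0 ≤ j := by nlinarith
    have hj2 : j ≤ 1 := by nlinarith
    interval_cases i <;> interval_cases j <;> simp_all <;> decide

/-! ## The standard layered set in codes -/

/-- **`layeredSet A a s z` is the image of the standard layered set under `A`.** [folklore] -/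
theorem layeredSet_eq_image (A : E3 →ₗᵢ[ℝ] E3) (a : ℝ) (s : ℤ → ℤ) (z : ℤ → ℝ) :
    layeredSet A a s z = A '' stdL a s z := by
  ext p
  simp only [layeredSet, stdL, Set.mem_image, Set.mem_setOf_eq, pt, combo_eq]
  constructor
  · rintro ⟨m, i, j, rfl⟩; exact ⟨_, ⟨m, i, j, rfl⟩, rfl⟩
  · rintro ⟨q, ⟨m, i, j, rfl⟩, rfl⟩; exact ⟨m, i, j, rfl⟩

/-- Points of `stdL` are in `stdL`. [folklore] -/
theorem pt_mem_stdL (a : ℝ) (s : ℤ → ℤ) (z : ℤ → ℝ) (m i j : ℤ) : pt a s z m i j ∈ stdL a s z :=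
  ⟨m, i, j, rfl⟩

/-- In-plane lattice translates of pattern points are pattern points. [folklore] -/
theorem lat_add_pt (a : ℝ) (s : ℤ → ℤ) (z : ℤ → ℝ) (m i j i' j' : ℤ) :
    lat a (3 * i', 3 * j') + pt a s z m i j = pt a s z m (i + i') (j + j') := by
  have e : ((3 * i', 3 * j') : ℤ × ℤ) + (3 * i + haggLabel s m, 3 * j + haggLabel s m) =
      (3 * (i + i') + haggLabel s m, 3 * (j + j') + haggLabel s m) := by
    ext <;> simp <;> ring
  simp only [pt, ← add_assoc, ← lat_add, e]

/-- `L 1 = s 0` and `L (-1) = -s (-1)` (the letters of the two layers adjacent to layer `0`).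
[folklore] -/
theorem haggLabel_pm_one (s : ℤ → ℤ) : haggLabel s 1 = s 0 ∧ haggLabel s (-1) = -s (-1) := by
  constructor
  · have h := haggLabel_succ s 0
    rw [zero_add, haggLabel_zero, zero_add] at h
    exact h
  · have h := haggLabel_succ s (-1)
    rw [show (-1 : ℤ) + 1 = 0 from rfl, haggLabel_zero] at h
    linarith

section Admissible

variable {s : ℤ → ℤ} {z : ℤ → ℝ}

/-- Heights grow at least linearly. [folklore] -/
theorem z_add_natCast_ge (hadm : IsAdmissibleLayering a s z) (m : ℤ) (n : ℕ) :
    z m + n * (39 / 50 * a) ≤ z (m + n) := by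
  induction n with
  | zero => simp
  | succ n ih =>
    have h := (hadm.2.2.2 (m + n)).1
    push_cast at h ⊢
    rw [← add_assoc]
    linarith

/-- **Only the layers `m = 0, ±1` come within `28/25` of the base point.** [folklore] -/
theorem abs_le_one_of_abs_z_le (hadm : IsAdmissibleLayering a s z) (hz0 : z 0 = 0) {m : ℤ}
    (hm : |z m| ≤ 28 / 25) : -1 ≤ m ∧ m ≤ 1 := by
  have ha := hadm.1
  rw [abs_le] at hm
  by_contra hcon
  rcases lt_or_gt_of_ne (show m ≠ 0 by omega) with hneg | hpos
  · have h := z_add_natCast_ge hadm m (-m).toNat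
    have e1 : (((-m).toNat : ℕ) : ℤ) = -m := Int.toNat_of_nonneg (by omega)
    have e : (((-m).toNat : ℕ) : ℝ) = -(m : ℝ) := by exact_mod_cast e1
    rw [e1, e, show m + -m = 0 by ring, hz0] at h
    have hm2 : (2 : ℝ) ≤ -(m : ℝ) := by exact_mod_cast (show (2 : ℤ) ≤ -m by omega)
    have : (2 : ℝ) * (39 / 50 * a) ≤ -(m : ℝ) * (39 / 50 * a) :=
      mul_le_mul_of_nonneg_right hm2 (by positivity)
    linarith [hm.1]
  · have h := z_add_natCast_ge hadm 0 m.toNat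
    have e1 : ((m.toNat : ℕ) : ℤ) = m := Int.toNat_of_nonneg (by omega)
    have e : ((m.toNat : ℕ) : ℝ) = (m : ℝ) := by exact_mod_cast e1
    rw [e1, e, zero_add, hz0] at h
    have hm2 : (2 : ℝ) ≤ (m : ℝ) := by exact_mod_cast (show (2 : ℤ) ≤ m by omega)
    have : (2 : ℝ) * (39 / 50 * a) ≤ (m : ℝ) * (39 / 50 * a) :=
      mul_le_mul_of_nonneg_right hm2 (by positivity)
    linarith [hm.2]

/-- The height of a coded point is at most its norm. [folklore] -/
theorem sq_le_norm_coded_sq (a : ℝ) (c : ℤ × ℤ) (t : ℝ) : t ^ 2 ≤ ‖lat a c + t • e3‖ ^ 2 := by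
  rw [norm_coded_sq]
  have := Qf_nonneg c
  have : (0 : ℝ) ≤ Qf c := by exact_mod_cast this
  nlinarith [sq_nonneg a]

/-- **Off-plane shell points sit over the nearest holes.** [folklore] -/
theorem mem_upCodes_of_norm_le (ha : 47 / 50 ≤ a ∧ a ≤ 1) {σ : ℤ} (hσ : σ = 1 ∨ σ = -1) {t : ℝ}
    (ht : (39 / 50 * a) ^ 2 ≤ t ^ 2) {i j : ℤ}
    (hle : ‖lat a (3 * i + σ, 3 * j + σ) + t • e3‖ ≤ 28 / 25) :
    ((3 * i + σ, 3 * j + σ) : ℤ × ℤ) ∈ upCodes σ := by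
  apply upCodes_of_form_eq_zero hσ
  set K : ℤ := i ^ 2 + i * j + j ^ 2 + σ * (i + j) with hK
  have hσ2 : σ ^ 2 = 1 := by rcases hσ with rfl | rfl <;> norm_num
  have hQ : Qf (3 * i + σ, 3 * j + σ) = 9 * K + 3 := by
    simp only [Qf, hK]; linear_combination 3 * hσ2
  have hsq : ‖lat a (3 * i + σ, 3 * j + σ) + t • e3‖ ^ 2 ≤ (28 / 25) ^ 2 :=
    pow_le_pow_left₀ (norm_nonneg _) hle 2
  rw [norm_coded_sq, hQ] at hsq
  push_cast at hsq
  have hK1 : (K : ℝ) < 1 := by nlinarith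
  have hK0 : (-1 : ℝ) < K := by
    have := Qf_nonneg (3 * i + σ, 3 * j + σ)
    rw [hQ] at this
    have : (-1 : ℤ) < K := by omega
    exact_mod_cast this
  have h1 : K < 1 := by exact_mod_cast hK1
  have h0 : -1 < K := by exact_mod_cast hK0
  omega

/-- **The first shell of the standard layered set is the shell pattern**: a nonzero pattern
point of norm `≤ 28/25` is one of the twelve points of
`shellSet a (s 0) (z 1) (−s (−1)) (z (−1))`. [folklore] -/
theorem mem_shellSet_of_norm_le (hadm : IsAdmissibleLayering a s z) (hz0 : z 0 = 0) {p : E3}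
    (hp : p ∈ stdL a s z) (h0 : p ≠ 0) (hle : ‖p‖ ≤ 28 / 25) :
    p ∈ shellSet a (s 0) (z 1) (-s (-1)) (z (-1)) := by
  obtain ⟨ha1, ha2, hs, hz⟩ := hadm
  have ha0 : a ≠ 0 := by linarith
  obtain ⟨m, i, j, rfl⟩ := hp
  have hzm : |z m| ≤ 28 / 25 := by
    have h1 := sq_le_norm_coded_sq a (3 * i + haggLabel s m, 3 * j + haggLabel s m) (z m)
    have h2 : ‖pt a s z m i j‖ ^ 2 ≤ (28 / 25) ^ 2 := pow_le_pow_left₀ (norm_nonneg _) hle 2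
    exact abs_le_of_sq_le_sq' (by unfold pt at h2; linarith) (by norm_num) |>.elim
      (fun h h' => abs_le.2 ⟨h, h'⟩)
  obtain ⟨hm1, hm2⟩ := abs_le_one_of_abs_z_le ⟨ha1, ha2, hs, hz⟩ hz0 hzm
  rw [pt, coded_mem_shellSet_iff ha0]
  interval_cases m
  · -- layer `-1`
    right; right
    have hL : haggLabel s (-1) = -s (-1) := (haggLabel_pm_one s).2
    refine ⟨?_, rfl⟩
    rw [hL]
    have hσ : -s (-1) = 1 ∨ -s (-1) = -1 := by rcases hs (-1) with h | h <;> omega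
    refine mem_upCodes_of_norm_le ⟨ha1, ha2⟩ hσ ?_ (by rwa [pt, hL] at hle)
    have h := (hz (-1)).1
    rw [show (-1 : ℤ) + 1 = 0 from rfl, hz0] at h
    nlinarith
  · -- layer `0`
    left
    simp only [haggLabel_zero, add_zero, hz0, and_true]
    apply hexCodes_of_form_eq_one
    have hsq : ‖pt a s z 0 i j‖ ^ 2 ≤ (28 / 25) ^ 2 := pow_le_pow_left₀ (norm_nonneg _) hle 2
    rw [pt, norm_coded_sq, haggLabel_zero, hz0] at hsq
    simp only [add_zero, Qf] at hsq
    push_cast at hsq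
    set K : ℤ := i ^ 2 + i * j + j ^ 2 with hK
    have hK2 : (K : ℝ) < 2 := by push_cast [hK]; nlinarith
    have hKne : K ≠ 0 := by
      intro hK0
      have hi2 : i ^ 2 ≤ 0 := by nlinarith [sq_nonneg (2 * j + i)]
      have hj2 : j ^ 2 ≤ 0 := by nlinarith [sq_nonneg (2 * i + j)]
      have hi : i = 0 := (pow_eq_zero_iff two_ne_zero).1 (le_antisymm hi2 (sq_nonneg i))
      have hj : j = 0 := (pow_eq_zero_iff two_ne_zero).1 (le_antisymm hj2 (sq_nonneg j))
      apply h0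
      rw [pt, haggLabel_zero, hz0, hi, hj, zero_smul, add_zero]
      exact lat_zero a
    have hK0 : 0 ≤ K := by nlinarith [sq_nonneg (2 * i + j), sq_nonneg j]
    have : K < 2 := by exact_mod_cast hK2
    omega
  · -- layer `1`
    right; left
    have hL : haggLabel s 1 = s 0 := (haggLabel_pm_one s).1
    refine ⟨?_, rfl⟩
    rw [hL]
    refine mem_upCodes_of_norm_le ⟨ha1, ha2⟩ (hs 0) ?_ (by rwa [pt, hL] at hle)
    have h := (hz 0).1
    rw [zero_add, hz0] at h
    nlinarith

/-- **The shell pattern lies in the standard layered set.** [folklore] -/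
theorem shellSet_subset_stdL (hs : IsHaggSeq s) (hz0 : z 0 = 0) :
    shellSet a (s 0) (z 1) (-s (-1)) (z (-1)) ⊆ stdL a s z := by
  intro v hv
  obtain ⟨c, t, rfl, h | h | h⟩ := exists_of_mem_shellSet hv
  · obtain ⟨hc, rfl⟩ := h
    obtain ⟨i, j, rfl⟩ := exists_eq_of_mem_hexCodes hc
    refine ⟨0, i, j, ?_⟩
    simp [pt, hz0]
  · obtain ⟨hc, rfl⟩ := h
    obtain ⟨i, j, rfl⟩ := exists_eq_of_mem_upCodes (hs 0) hc
    exact ⟨1, i, j, by rw [pt, (haggLabel_pm_one s).1]⟩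
  · obtain ⟨hc, rfl⟩ := h
    have hσ : -s (-1) = 1 ∨ -s (-1) = -1 := by rcases hs (-1) with h | h <;> omega
    obtain ⟨i, j, rfl⟩ := exists_eq_of_mem_upCodes hσ hc
    exact ⟨-1, i, j, by rw [pt, (haggLabel_pm_one s).2]⟩

end Admissible

/-! ## Norm bounds -/

/-- **Norms of the shell points**: strictly between `9/10` and `21/20`. [folklore] -/
theorem norm_shell_bounds (ha : 47 / 50 ≤ a ∧ a ≤ 1) {σ₁ σ₂ : ℤ} (h₁ : σ₁ = 1 ∨ σ₁ = -1)
    (h₂ : σ₂ = 1 ∨ σ₂ = -1) {t₁ t₂ : ℝ} (ht₁ : 39 / 50 * a ≤ |t₁| ∧ |t₁| ≤ 17 / 20 * a)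
    (ht₂ : 39 / 50 * a ≤ |t₂| ∧ |t₂| ≤ 17 / 20 * a) {v : E3} (hv : v ∈ shellSet a σ₁ t₁ σ₂ t₂) :
    9 / 10 < ‖v‖ ∧ ‖v‖ < 21 / 20 := by
  have key : ∀ x : ℝ, 0 ≤ x → (9 / 10) ^ 2 < x ^ 2 → x ^ 2 < (21 / 20) ^ 2 → 9 / 10 < x ∧ x < 21 / 20 :=
    fun x hx h1 h2 => ⟨by nlinarith, by nlinarith⟩
  apply key _ (norm_nonneg _)
  all_goals obtain ⟨c, t, rfl, h | h | h⟩ := exists_of_mem_shellSet hv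
  all_goals obtain ⟨hc, ht⟩ := h
  all_goals rw [ht, norm_coded_sq]
  any_goals rw [Qf_of_mem_hexCodes hc]
  any_goals rw [Qf_of_mem_upCodes h₁ hc]
  any_goals rw [Qf_of_mem_upCodes h₂ hc]
  all_goals push_cast
  · nlinarith
  · have := sq_abs t₁; nlinarith [abs_nonneg t₁]
  · have := sq_abs t₂; nlinarith [abs_nonneg t₂]
  · nlinarith
  · have := sq_abs t₁; nlinarith [abs_nonneg t₁]
  · have := sq_abs t₂; nlinarith [abs_nonneg t₂]

/-- The admissible bounds on the heights `z 1`, `z (-1)` in absolute-value form. [folklore] -/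
theorem abs_heights_of_adm {s : ℤ → ℤ} {z : ℤ → ℝ} (hadm : IsAdmissibleLayering a s z)
    (hz0 : z 0 = 0) :
    (39 / 50 * a ≤ |z 1| ∧ |z 1| ≤ 17 / 20 * a) ∧ (39 / 50 * a ≤ |z (-1)| ∧ |z (-1)| ≤ 17 / 20 * a) ∧
      0 < z 1 ∧ z (-1) < 0 := by
  obtain ⟨ha1, -, -, hz⟩ := hadm
  have h1 := hz 0
  have h2 := hz (-1)
  rw [zero_add, hz0] at h1
  rw [show (-1 : ℤ) + 1 = 0 from rfl, hz0] at h2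
  have hp : 0 < z 1 := by linarith
  have hn : z (-1) < 0 := by linarith
  rw [abs_of_pos hp, abs_of_neg hn]
  exact ⟨⟨by linarith, by linarith⟩, ⟨by linarith, by linarith⟩, hp, hn⟩

/-- **Uniform discreteness of an admissible layered set**: nonzero pattern points have norm
`> 9/10`. [folklore] -/
theorem norm_gt_of_mem_stdL {s : ℤ → ℤ} {z : ℤ → ℝ} (hadm : IsAdmissibleLayering a s z)
    (hz0 : z 0 = 0) {p : E3} (hp : p ∈ stdL a s z) (h0 : p ≠ 0) : 9 / 10 < ‖p‖ := by
  by_cases hle : ‖p‖ ≤ 28 / 25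
  · have hs := hadm.2.2.1
    obtain ⟨h1, h2, -, -⟩ := abs_heights_of_adm hadm hz0
    have hσ : -s (-1) = 1 ∨ -s (-1) = -1 := by rcases hs (-1) with h | h <;> omega
    exact (norm_shell_bounds ⟨hadm.1, hadm.2.1⟩ (hs 0) hσ h1 h2
      (mem_shellSet_of_norm_le hadm hz0 hp h0 hle)).1
  · linarith

/-- **Second-shell bound**: a hexagon vector plus a different shell point has norm `≤ 9/5`.
[folklore] -/
theorem norm_lat_add_le (ha : 47 / 50 ≤ a ∧ a ≤ 1) {σ₁ σ₂ : ℤ} (h₁ : σ₁ = 1 ∨ σ₁ = -1)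
    (h₂ : σ₂ = 1 ∨ σ₂ = -1) {t₁ t₂ : ℝ} (ht₁ : |t₁| ≤ 17 / 20 * a) (ht₂ : |t₂| ≤ 17 / 20 * a)
    {c : ℤ × ℤ} (hc : c ∈ hexCodes) {v : E3} (hv : v ∈ shellSet a σ₁ t₁ σ₂ t₂)
    (hne : v ≠ lat a c) : ‖lat a c + v‖ ≤ 9 / 5 := by
  have ha0 : a ≠ 0 := by linarith [ha.1]
  suffices h : ‖lat a c + v‖ ^ 2 ≤ (9 / 5) ^ 2 by
    nlinarith [norm_nonneg (lat a c + v)]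
  obtain ⟨c', t, rfl, h | h | h⟩ := exists_of_mem_shellSet hv <;> obtain ⟨hc', ht⟩ := h <;>
    rw [ht, lat_eq_coded a c, coded_add, norm_coded_sq]
  · have hne' : c' ≠ c := by rintro rfl; exact hne (by rw [ht]; simp)
    have := Qf_hex_add_hex hc hc' hne'
    have : (Qf (c + c') : ℝ) ≤ 27 := by exact_mod_cast this
    nlinarith
  · have := Qf_hex_add_up h₁ hc hc'
    have : (Qf (c + c') : ℝ) ≤ 21 := by exact_mod_cast this
    have := sq_abs t₁
    nlinarith [abs_nonneg t₁]
  · have := Qf_hex_add_up h₂ hc hc'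
    have : (Qf (c + c') : ℝ) ≤ 21 := by exact_mod_cast this
    have := sq_abs t₂
    nlinarith [abs_nonneg t₂]

/-- **Main statement of this file**: the first shell of the standard admissible layered set is
the shell pattern. [folklore] -/
theorem globalize_shell_classification : ∀ (a : ℝ) (s : ℤ → ℤ) (z : ℤ → ℝ), IsAdmissibleLayering a s z → z 0 = 0 → ∀ p ∈ stdL a s z, p ≠ 0 → ‖p‖ ≤ 28 / 25 → p ∈ shellSet a (s 0) (z 1) (-s (-1)) (z (-1)) :=
  fun _ _ _ hadm hz0 _ hp h0 hle => mem_shellSet_of_norm_le hadm hz0 hp h0 hle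

end Summit.AtomisticToContinuum.Crystallization.Theorems.SlackRigidityPricedFloorsGlobalize

end
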